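import Summits.ABC.IUTFork.Cor312PilotKummerNaturalWitness
import HarnessLib

/-!
# [IUTchIII] Cor. 3.12 — the NATURAL model with an HONEST ACTION, P♮⁺: abc-iut-w5-d230's P♮ with ONE field changed, the [multiplicative]
# action (i)(b) `MRData.act := coordinatewise multiplication` instead of the zero map

Record file (D-0012; MODEL DATA + proofs, no `Prop` fact) of the abc-iut cell, IUT REPAIR branch (rung LADDER-ABC:A2.RP; abc-iut-rp-plan
RULINGS #18, 2026-08-26T07:24Z: «w5-d230: is a NONZERO-act variant of P♮ (act := multiplication, shells stable) cheap? if ≤ 60 min please build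
it as part IV» — built by abc-iut-rp-d2 after the conditional claim HOME/STATUS 07:47Z, no objection; flat per RULINGS #14/#19 so the farm
prebuilds it). TAKES NO SIDE on [IUTchIII] Cor. 3.12 or on any author; a model of READING PREDICATES is a consistency witness, not an
endorsement; toy carriers (one place, `l⋇ = 2`); typed ≠ proved; instantiated ≠ endorsed.

WHY. In P♮ (`Cor312PilotKummerNaturalModel`, p429573) the data (b) action `natData.act` is `0` («no action needed: 0»), so every log-shell
saturation «X · 𝓘» (`Repair.CandInternal2.shellSat`, the frozen-vocabulary typing of (Ind3)-as-containers) is the zero tuple and every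
act-reading row of the repair table gets a DEGENERATE ✗ at P♮ (`Repair.CandInternal2Nat`, caveat recorded verbatim in APPENDIX-J). P♮⁺ keeps
EVERY other datum of P♮ (sign shells, hull frame `natFrame`, volume `natVol`, splitting monoid `PsiNat = {onePt}`, column `natColumn` with
identity Kummer transport, link data `naiveLink`, honest object side `pinSig`/`ExpMonoid`, glue `thetaRegionNat`/`qRegionNat`, operator
`segRegion`, q-datum `qDatumNat = flipFamily·Ψ`) and sets `act v hv ψ := (ι ↦ (line ψ_j · ι_j)_j)` — the coordinatewise multiplication of
abc-iut-w5-d247's naive model ([IUTchIII] `paper:url-4b091feeb646` Thm. 3.11 (i) (b) p. 154 «equipped with a(n) [multiplicative] action on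
∏_{j ∈ 𝔽_l^⋇} 𝓘^ℚ(…)»). [claim: Mochizuki2012, status: disputed]

RESULTS (ns `Summit.ABC.IUTFork.Cor312Vol.NaturalActWitness`): `actData`/`actSituation`/`actFull`/`actSetting` (the model); `actFull_statement`
(typed Thm. 3.11 (i)–(iii): the action does not enter (i)(a)(c), (ii), (iii); (i)(b) sub-packet clause as in P♮); the P♮ computations
re-derived VERBATIM for the new carrier (`act_thetaRegion3`/`act_qRegion`/`act_possibleImages`/`act_thetaHull` (= `ball` on `𝔽_l^⋇`, `{0}` at the
zero label)/`act_negLogTheta = −1`/`act_negLogQ = −2`/`act_absLogQPos`/`act_statement_strict`/`act_bridgeHyps`); the THREE PINS for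
`(segRegion, qDatumNat)` (`act_pinnedRegions3`); **S = `PilotKummerIndRelated` HOLDS through the genuine (Ind2)-move `flipFamily`**
(`act_pilotKummerIndRelated`), NOT identified (`act_regions_ne`); the hull clause (`act_pilotKummerCompatHull`); and the SAT♮ ENGINE
`satNaturalAct_of_holds` (an arbitrary candidate `H` true at P♮⁺ ⊢ `H ∧` typed Thm 3.11 ∧ BridgeHyps ∧ AbsLogQPos ∧ PinnedRegions3 ∧ S ∧
hull clause ∧ strict Statement). The P♮⁺ cells of the log-shell rows are the sequel `Repair/CandInternal2NatAct`.
-/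

noncomputable section

open Set

namespace Summit.ABC.IUTFork.Cor312Vol

namespace NaturalActWitness

open Thm311 Cor312 Cor312.Checks Cor312.IdentifiedNonVacuity NaiveWitness PinnedWitness NaturalWitness Literature.IUT.LogThetaLattice

/-! ## 1. The model: P♮ with the honest coordinatewise action -/

/-- **The data (a)(b)(c) of P♮⁺**: abc-iut-w5-d230's `natData` with `act v hv ψ :=` coordinatewise multiplication by the line-coordinates
of `ψ` (as in abc-iut-w5-d247's `naiveData`). MODEL DATA. [claim: Mochizuki2012, status: disputed] -/
def actData : MRData signShells :=
  { natData with act := fun v _ y => LinearMap.pi fun j => (line j.1 (toyIndex.over v) (y j)) • LinearMap.proj j }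

/-- The SITUATION of P♮⁺ (same data on every vertical line). (An `abbrev`.) [claim: Mochizuki2012, status: disputed] -/
abbrev actSituation : Situation toyIndex where
  L := signShells
  D := fun _ => actData
  G := fun _ j => natDegrees j

/-- The FULL SITUATION of P♮⁺: P♮'s column and link data verbatim. (An `abbrev`.) [claim: Mochizuki2012, status: disputed] -/
abbrev actFull : FullSituation toyIndex where
  toSituation := actSituation
  col := fun _ => natColumn
  link := naiveLink

/-- **The setting P♮⁺ of Cor. 3.12** over `actSituation`: P♮'s setting field by field (honest object side, frame `natFrame`, glue
`thetaRegionNat`/`qRegionNat`). MODEL DATA. [claim: Mochizuki2012, status: disputed] -/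
def actSetting : Setting actSituation where
  n := 0
  HT := ℤ × ℤ
  LogLink := fun _ _ => Unit
  IsFull := fun _ => True
  lattice :=
    { theater := fun n m => (n, m)
      distinct := fun p q h => by simpa using h
      logLink := fun _ _ => ()
      logLink_full := fun _ _ => trivial }
  Frd := Unit
  IsoF := fun _ _ => Unit
  Ob := fun _ => ℤ
  realify := id
  Strip := Unit
  IsoS := fun _ _ => Unit
  M := fun _ _ => ExpMonoid
  sig := pinSig
  split := { Msplit := fun _ _ => ⊤, exists_gen := fun _ _ => ⟨⟨gen, trivial⟩, top_gen_isGenerator⟩ }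
  ObΔ := ℤ
  N := fun _ _ => ExpMonoid
  qData :=
    { q := fun _ _ => gen
      q_gen := fun _ _ => gen_isGenerator
      objOf := fun x => (expOf (x () (Set.mem_univ ())) : ℤ) }
  frame := fun j vQ => natFrame j vQ
  hul_adm := fun _ _ _ _ => trivial
  thetaRegionOf := fun _ k j vQ => thetaRegionNat k j vQ
  qRegionOf := fun k j vQ => qRegionNat k j vQ
  qRegion_mem := fun j vQ => qRegionNat_one_mem_natHul j vQ
  qSupport_finite := fun _ => Set.toFinite _

/-- **The action of P♮⁺ is honest**: the line coordinate of a component of `ψ · ι` is the product of the coordinates. [folklore] -/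
theorem act_line (n : ℤ) (v : toyIndex.V) (hv : v ∈ toyIndex.Vbad) (ψ ι : signShells.StarPacket v) (j : toyIndex.LabelStar) :
    line j.1 (toyIndex.over v) ((actFull.toLatticeSituation.D n).act v hv ψ ι j) =
      line j.1 (toyIndex.over v) (ψ j) * line j.1 (toyIndex.over v) (ι j) := by
  show line j.1 (toyIndex.over v) ((line j.1 (toyIndex.over v) (ψ j)) • ι j) = _
  rw [map_smul, smul_eq_mul]

/-- On the Θ-point `onePt` (all coordinates `1`) the action is the identity: `onePt · ι = ι`. [folklore] -/
theorem act_onePt (n : ℤ) (v : toyIndex.V) (hv : v ∈ toyIndex.Vbad) (ι : signShells.StarPacket v) :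
    (actFull.toLatticeSituation.D n).act v hv (onePt v) ι = ι := by
  funext j
  show (line j.1 (toyIndex.over v) (onePt v j)) • ι j = ι j
  rw [show onePt v j = lpt j.1 (toyIndex.over v) 1 from rfl, line_lpt, one_smul]

/-! ## 2. The typed Theorem 3.11 holds for P♮⁺ (the action does not enter its clauses) -/

/-- (i). [folklore] -/
theorem act_partI : actFull.PartI := by
  refine ⟨fun n v hv x _ j => ?_, fun n j k => ⟨fun vQ => trivial, Set.toFinite _, ?_⟩, fun _ _ => rfl⟩
  · show x j ∈ signShells.SubPacket j.1 v
    rw [subPacket_eq_top]; trivial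
  · show (-1 : ℝ) = ∑ᶠ vQ : toyIndex.VQ, natVol j.1 vQ (ball j.1 vQ)
    rw [finsum_unique]
    exact (natVol_values j.1 _).2.2.2.1.symm

/-- (ii). [folklore] -/
theorem act_partII : actFull.toLatticeSituation.PartII := fun _ =>
  (Column.partII_iff _ _).2
    ⟨fun _ _ _ _ _ => ⟨trivial, rfl⟩, fun _ _ _ => rfl, fun _ _ => rfl, fun _ _ _ _ _ => subset_rfl,
      fun _ _ _ h => absurd trivial h⟩

/-- (iii). [folklore] -/
theorem act_partIII : actFull.PartIII := by
  refine ⟨naiveLink.partIIIa_holds, naiveLink.partIIIb_holds, ?_, fun n m => Thm311.PolyIsoCalc.stabilized_full _ _,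
    actFull.evalCompatUpToInd_of_multiradialCompat act_partI.2.2⟩
  refine naiveLink.partIIIc_of_full (fun _ => rfl) fun n m => ?_
  rintro _ ⟨a, rfl⟩
  show unitIso a ≪≫ unitIso ((-1) ^ m.natAbs) = unitIso ((-1) ^ m.natAbs) ≪≫ unitIso a
  rw [unitIso_trans, unitIso_trans, mul_comm]

/-- **The typed Theorem 3.11 (i) ∧ (ii) ∧ (iii) HOLDS in P♮⁺.** [folklore] -/
theorem actFull_statement : actFull.Statement := ⟨act_partI, act_partII, act_partIII⟩

/-! ## 3. Pilots, regions, hull, volumes (P♮'s computations, verbatim for the new carrier) -/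

/-- The pilots are the objects of exponent `1`. [folklore] -/
theorem act_pilots : actSetting.thetaPilot = (1 : ℤ) ∧ actSetting.qPilot = (1 : ℤ) :=
  ⟨congrArg (Nat.cast : ℕ → ℤ)
    (expOf_eq_one_of_isGenerator_top (Classical.choose_spec (actSetting.split.exists_gen () (Set.mem_univ ())))), rfl⟩

/-- The Kummer image of the Θ-pilot at `(m, j, v_ℚ)` is `thetaRegionNat 1`. [folklore] -/
theorem act_thetaRegion (m : ℤ) (j : toyIndex.Label) (vQ : toyIndex.VQ) : actSetting.thetaRegion m j vQ = thetaRegionNat 1 j vQ := by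
  unfold Setting.thetaRegion; rw [act_pilots.1]; rfl

/-- The (Ind3)-enlarged Θ-region. [folklore] -/
theorem act_thetaRegion3 (j : toyIndex.Label) (vQ : toyIndex.VQ) : actSetting.thetaRegion3 j vQ = thetaRegionNat 1 j vQ := by
  show (⋃ m : ℤ, actSetting.thetaRegion m j vQ) = _
  simp_rw [act_thetaRegion]; exact Set.iUnion_const _

/-- The q-pilot image. [folklore] -/
theorem act_qRegion (j : toyIndex.Label) (vQ : toyIndex.VQ) : actSetting.qRegion j vQ = qRegionNat 1 j vQ := rfl

/-- On `𝔽_l^⋇`: Θ-region `halfPos`, q-region `halfNeg`. [folklore] -/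
theorem act_regions_of_ne_zero {j : toyIndex.Label} (hj : j ≠ 0) (vQ : toyIndex.VQ) :
    actSetting.thetaRegion3 j vQ = halfPos j vQ ∧ actSetting.qRegion j vQ = halfNeg j vQ := by
  rw [act_thetaRegion3, act_qRegion, thetaRegionNat_one_of_ne_zero hj, qRegionNat_one_of_ne_zero hj]
  exact ⟨rfl, rfl⟩

/-- `flipFamily` lies in the (Ind1)(Ind2)-group. [folklore] -/
theorem flipFamily_mem_indGroup_act : flipFamily ∈ Setting.indGroup actSituation :=
  Subgroup.subset_closure (Or.inr flipFamily_mem_Ind2Family)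

/-- The possible images at a label of `𝔽_l^⋇` are the two half-shells. [folklore] -/
theorem act_possibleImages {j : toyIndex.Label} (hj : j ≠ 0) (vQ : toyIndex.VQ) :
    actSetting.possibleImages j vQ = {halfPos j vQ, halfNeg j vQ} := by
  ext U
  rw [Setting.possibleImages, (act_regions_of_ne_zero hj vQ).1]
  constructor
  · rintro ⟨Φ, hΦ, rfl⟩
    rcases image_eq_or_of_actsBySigns (actsBySigns_of_mem_closure hΦ) j vQ (halfPos j vQ) with e | e
    · exact Or.inl e
    · rw [e, (negSet_hul j vQ).2.1]; exact Or.inr rfl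
  · rintro (rfl | rfl)
    · exact ⟨1, (Setting.indGroup actSituation).one_mem, by simp⟩
    · exact ⟨flipFamily, flipFamily_mem_indGroup_act, (image_halfPos_flipFamily j vQ).symm⟩

/-- At the zero label the only possible image is `{0}`. [folklore] -/
theorem act_possibleImages_zero (vQ : toyIndex.VQ) : actSetting.possibleImages 0 vQ = {{0}} := by
  ext U
  rw [Setting.possibleImages, act_thetaRegion3, (regionNat_zero 1 vQ).1]
  constructor
  · rintro ⟨Φ, -, rfl⟩
    rw [Set.mem_singleton_iff, Set.image_singleton, map_zero]
  · rintro rfl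
    exact ⟨1, (Setting.indGroup actSituation).one_mem, by simp⟩

/-- The hull at a label of `𝔽_l^⋇` is the shell `ball`. [folklore] -/
theorem act_thetaHull {j : toyIndex.Label} (hj : j ≠ 0) (vQ : toyIndex.VQ) : actSetting.thetaHull j vQ = ball j vQ := by
  unfold Setting.thetaHull
  rw [act_possibleImages hj, Set.sUnion_insert, Set.sUnion_singleton, halfPos_union_halfNeg]
  exact (natFrame j vQ).hull_eq_self_of_mem (ball_mem_natHul j vQ)

/-- The hull at the zero label is `{0}`. [folklore] -/
theorem act_thetaHull_zero (vQ : toyIndex.VQ) : actSetting.thetaHull 0 vQ = {0} := by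
  unfold Setting.thetaHull
  rw [act_possibleImages_zero, Set.sUnion_singleton]
  exact (natFrame 0 vQ).hull_eq_self_of_mem (zero_mem_natHul 0 vQ)

/-- Every union of possible images admits its hull. [folklore] -/
theorem act_hullDefined (j : toyIndex.Label) (vQ : toyIndex.VQ) : actSetting.HullDefined j vQ := ⟨trivial, trivial⟩

/-- The local Θ-contribution at a label of `𝔽_l^⋇` is `−1`. [folklore] -/
theorem act_thetaLocal (i : Fin toyIndex.lstar) (vQ : toyIndex.VQ) :
    actSetting.thetaLocal (Setting.labelSucc i) vQ = ((-1 : ℝ) : WithTop ℝ) := by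
  unfold Setting.thetaLocal
  rw [if_pos (act_hullDefined _ vQ), act_thetaHull (Setting.labelSucc_ne_zero i)]
  exact congrArg _ (natVol_values _ vQ).2.2.2.1

/-- The local q-contribution at a label of `𝔽_l^⋇` is `−2`. [folklore] -/
theorem act_qLocal (i : Fin toyIndex.lstar) (vQ : toyIndex.VQ) : actSetting.qLocal (Setting.labelSucc i) vQ = -2 := by
  unfold Setting.qLocal
  rw [(act_regions_of_ne_zero (Setting.labelSucc_ne_zero i) vQ).2]
  exact (natVol_values _ vQ).2.2.1

/-- `−|log(Θ)|` is finite. [folklore] -/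
theorem act_thetaFinite : actSetting.ThetaFinite :=
  ⟨fun i vQ => by rw [act_thetaLocal]; exact WithTop.coe_ne_top, fun _ => Set.toFinite _⟩

/-- `−|log(Θ)| = −1`. [folklore] -/
theorem act_negLogTheta : actSetting.negLogTheta = ((-1 : ℝ) : WithTop ℝ) := by
  rw [actSetting.negLogTheta_eq_of_thetaFinite act_thetaFinite]
  simp only [act_thetaLocal, WithTop.untopD_coe, finsum_unique]
  exact congrArg _ (processionNormalized_const (by decide) (-1))

/-- `−|log(q)| = −2`. [folklore] -/
theorem act_negLogQ : actSetting.negLogQ = -2 := by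
  unfold Setting.negLogQ
  simp only [act_qLocal, finsum_unique]
  exact processionNormalized_const (by decide) (-2)

/-- `|log(q)| > 0`. [folklore] -/
theorem act_absLogQPos : actSetting.AbsLogQPos := by
  show actSetting.negLogQ < 0; rw [act_negLogQ]; norm_num

/-- **The printed Statement HOLDS in P♮⁺, STRICTLY** (`−2 < −1`). [folklore] -/
theorem act_statement_strict : actSetting.Statement ∧ ((actSetting.negLogQ : ℝ) : WithTop ℝ) < actSetting.negLogTheta := by
  refine ⟨(actSetting.statement_iff_real act_negLogTheta).2 (by rw [act_negLogQ]; norm_num), ?_⟩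
  rw [act_negLogTheta, act_negLogQ, WithTop.coe_lt_coe]; norm_num

/-- All bridge hypotheses hold. [folklore] -/
theorem act_bridgeHyps : BridgeHyps actSetting where
  mono := fun _ _ _ _ _ _ hAB => natVol_mono hAB
  image_adm := fun _ _ _ _ => trivial
  image_fin := fun _ => Set.toFinite _
  hul_nonempty := fun _ _ _ hH => ⟨0, zero_mem_of_mem_natHul hH⟩
  theta_nonempty := fun i vQ => by
    rw [(act_regions_of_ne_zero (Setting.labelSucc_ne_zero i) vQ).1]; exact ⟨0, zero_mem_halfPos _ vQ⟩
  finite := act_thetaFinite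

/-! ## 4. The three pins, S through the genuine (Ind2)-move, the hull clause -/

/-- (hρ) ∧ (pΘ) for `segRegion`. [claim: Mochizuki2012, status: disputed] -/
theorem act_thetaPinned : ThetaPinned actFull.toLatticeSituation actSetting segRegion := by
  refine ⟨fun Φ _ Ψ j vQ => segRegion_equivariant Φ Ψ j vQ, fun m j vQ => ?_⟩
  show actSetting.thetaRegion m j vQ = segRegion (fun v _ => PsiNat v) j vQ
  rw [act_thetaRegion]
  by_cases hj : j = 0
  · subst hj; rw [(regionNat_zero 1 vQ).1, segRegion_zero]
  · rw [thetaRegionNat_one_of_ne_zero hj, segRegion_PsiNat hj]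

/-- (pq′) for `qDatumNat`. [claim: Mochizuki2012, status: disputed] -/
theorem act_qPinned : QPinned actFull.toLatticeSituation actSetting segRegion qDatumNat := fun j vQ => by
  show actSetting.qRegion j vQ = segRegion qDatumNat j vQ
  rw [act_qRegion]
  by_cases hj : j = 0
  · subst hj; rw [(regionNat_zero 1 vQ).2, segRegion_zero]
  · rw [qRegionNat_one_of_ne_zero hj, segRegion_qDatumNat hj]

/-- (pL). [folklore] -/
theorem act_pilotLink : Thm311ToCor312.PilotLink actSetting :=
  ⟨Equiv.refl ℤ, by rw [act_pilots.1, act_pilots.2]; rfl⟩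

/-- **The three pins hold in P♮⁺.** [claim: Mochizuki2012, status: disputed] -/
theorem act_pinnedRegions3 : PinnedRegions3 actFull.toLatticeSituation actSetting segRegion qDatumNat :=
  ⟨⟨act_thetaPinned, act_qPinned⟩, act_pilotLink⟩

/-- **S = `PilotKummerIndRelated` HOLDS in P♮⁺** through the (Ind2)-move `flipFamily` (one genuine indeterminacy; not the identity).
[claim: Mochizuki2012, status: disputed] -/
theorem act_pilotKummerIndRelated : PilotKummerIndRelated actFull.toLatticeSituation actSetting segRegion qDatumNat := fun _ _ =>
  ⟨actData.map flipFamily, actData.map_mem_RLGP (Subgroup.subset_closure (Or.inr flipFamily_mem_Ind2Family)), rfl⟩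

/-- NOT identified: on `𝔽_l^⋇` the q-region `halfNeg` is not the Θ-region `halfPos`. [folklore] -/
theorem act_regions_ne {j : toyIndex.Label} (hj : j ≠ 0) (vQ : toyIndex.VQ) :
    actSetting.qRegion j vQ ≠ actSetting.thetaRegion3 j vQ := by
  rw [(act_regions_of_ne_zero hj vQ).1, (act_regions_of_ne_zero hj vQ).2]
  intro h
  have h1 : lpt j vQ (-1) ∈ halfPos j vQ := h ▸ (lpt_neg_one_mem j vQ).1
  exact (lpt_neg_one_mem j vQ).2.2 h1

/-- **The hull clause `PilotKummerCompatHull` HOLDS in P♮⁺** (`halfNeg ⊆ ball`; `{0} ⊆ {0}`). [claim: Mochizuki2012, status: disputed] -/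
theorem act_pilotKummerCompatHull : PilotKummerCompatHull actFull.toLatticeSituation actSetting segRegion qDatumNat := by
  intro j vQ
  by_cases hj : j = 0
  · subst hj; rw [segRegion_zero, act_thetaHull_zero]
  · rw [segRegion_qDatumNat hj, act_thetaHull hj]; exact halfNeg_subset_ball j vQ

/-- **The SAT♮ ENGINE at P♮⁺**: an arbitrary candidate `H` (bound variable of PR-1 arity) true at P♮⁺ is jointly satisfiable with typed
Thm. 3.11, BridgeHyps, |log(q)| > 0, the three pins, S (non-identified, through a genuine indeterminacy), the hull clause and the STRICT
Statement. One `exact` per candidate. [folklore] -/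
theorem satNaturalAct_of_holds
    (H : ∀ {T : ThetaIndex} (S : LatticeSituation T) (P : Cor312.Setting S.toSituation),
      ((∀ v : T.V, v ∈ T.Vbad → Set (S.L.StarPacket v)) → ∀ (j : T.Label) (vQ : T.VQ), Set (S.L.Packet j vQ)) →
      (∀ v : T.V, v ∈ T.Vbad → Set (S.L.StarPacket v)) → Prop)
    (h : H actFull.toLatticeSituation actSetting segRegion qDatumNat) :
    ∃ (T : ThetaIndex) (F : FullSituation T) (P : Cor312.Setting F.toLatticeSituation.toSituation)
      (ρ : (∀ v : T.V, v ∈ T.Vbad → Set (F.L.StarPacket v)) → ∀ (j : T.Label) (vQ : T.VQ), Set (F.L.Packet j vQ))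
      (qK : ∀ v : T.V, v ∈ T.Vbad → Set (F.L.StarPacket v)),
      F.Statement ∧ BridgeHyps P ∧ P.AbsLogQPos ∧ PinnedRegions3 F.toLatticeSituation P ρ qK ∧
        PilotKummerIndRelated F.toLatticeSituation P ρ qK ∧ PilotKummerCompatHull F.toLatticeSituation P ρ qK ∧
        (P.Statement ∧ ((P.negLogQ : ℝ) : WithTop ℝ) < P.negLogTheta) ∧ H F.toLatticeSituation P ρ qK :=
  ⟨toyIndex, actFull, actSetting, segRegion, qDatumNat, actFull_statement, act_bridgeHyps, act_absLogQPos, act_pinnedRegions3,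
    act_pilotKummerIndRelated, act_pilotKummerCompatHull, act_statement_strict, h⟩

end NaturalActWitness

end Summit.ABC.IUTFork.Cor312Vol

end
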